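import Mathlib
import Summits.ValiantsHypothesis.ValiantsHypothesis.Theorems.NewtonUnitEquationsNewtonTauWeakResidueNormalForm

/-!
# `NewtonUnitEquationsNewtonTauWeakResidueWeightedNormalForm` — Davenport exchange normal form for weighted residues

Registered stub `stub_residueWeightedNormalForm` (piece R1 of THEOREM G″) of line `binomial-normal-form` (crux
`NewtonTauWeak`, stmt-ValiantsHypothesis-5904, lead c6): the analogue of the exchange normal form
`stub_residueNormalForm` (THEOREM G, block popcounts) for ONE cyclic grading by arbitrary weights.

Setting.  Indices `j : Fin N` carry nonzero real values `c j` and natural weights `g j`; `q ≥ 1` is a modulus and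
`r` a residue.  `J` is *admissible* if `Σ_{j ∈ J} g j ≡ r (mod q)`.  The *class* of `j` is `g j % q`.
Claim: if an admissible `J` maximises `Σ_{j ∈ J} c j` among admissible sets, then for some `a b : ℕ → ℕ`
vanishing at `h ≥ q` and with `Σ_{h < q} (a h + b h) < q`, the CANONICAL set (all positives `j`, `c j > 0`, except
the `b h` cheapest of each class `h` for the key `(c j, j)`, plus the `a h` negatives closest to `0` of each class
`h`, key `(-c j, j)`) is admissible with the same value as `J`.

Proof (Davenport exchange argument).  `P` := positives, `M` := negatives (they partition `Fin N` as `c j ≠ 0`),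
`D := (M ∩ J) ∪ (P \ J)` = the items where `J` differs from `P`.
* (`ResidueWeightedNormalFormAux.exists_zero_sum`)  Among `≥ q` elements of `ℤ/q` some nonempty subfamily sums to
  `0`: two of the `q + 1` prefix sums coincide (pigeonhole; prefixes are taken along the rank order of
  `ResidueNormalFormAux.card_filter_rank_lt`).
* Davenport step: `|D| < q`.  Otherwise apply the previous point to the signed weights (`-g j` on `J`, `+g j`
  off `J`) to get a nonempty `E ⊆ D` with `Σ_{E \ J} g ≡ Σ_{E ∩ J} g (mod q)`; toggling `E` (remove
  `E ∩ J ⊆ M`, add `E \ J ⊆ P`) keeps `J` admissible and strictly increases its value — contradiction.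
* Canonicalisation, class by class, verbatim as in `ResidueNormalFormAux.normalForm_of_rank`: with
  `b h := |(P \ J) ∩ class h|`, `a h := |(M ∩ J) ∩ class h|` (so `Σ_h (a h + b h) = |D| < q`), the canonical
  set `K` has in every class as many elements as `J` (ranks are bijections onto initial segments), hence
  `Σ_K (g % q) = Σ_J (g % q)` and `K` is admissible, so `Σ_K c ≤ Σ_J c`; conversely the `b h` cheapest positives /
  the `a h` top negatives are extremal among subsets of their size (`ResidueNormalFormAux.sum_filter_rank_lt_le`),
  so `Σ_J c ≤ Σ_K c`.

Everything is folklore; no named facts, no citations, no `def`s (the canonical set is the parameter `canon`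
characterised by `hcanon`).
-/

-- Sub = Summit single-conjunct layout: the duplicated namespace component is mandated by the tree.
set_option linter.dupNamespace false

noncomputable section

open scoped BigOperators

namespace Summit.ValiantsHypothesis.ValiantsHypothesis.Theorems.NewtonUnitEquationsNewtonTauWeak

namespace ResidueWeightedNormalFormAux

variable {N : ℕ}

/-- **Davenport constant of `ℤ/q`.**  If `|D| ≥ q`, some nonempty `E ⊆ D` has `Σ_E z = 0` in `ZMod q`: the
`q + 1` sums over the prefixes `S t` (the `t` elements of `D` of least index, `t = 0, …, q`) take at most `q`
values, so two coincide, and the difference of the two prefixes is a nonempty zero-sum set.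
[folklore: pigeonhole on prefix sums] -/
theorem exists_zero_sum {q : ℕ} [NeZero q] (D : Finset (Fin N)) (z : Fin N → ZMod q) (hD : q ≤ D.card) :
    ∃ E ⊆ D, E.Nonempty ∧ ∑ x ∈ E, z x = 0 := by
  -- prefixes along the rank for the constant key `(0, x)`, i.e. along the index order
  obtain ⟨S, hS⟩ : ∃ S : ℕ → Finset (Fin N), ∀ t, S t = D.filter fun x =>
      (D.filter fun y => (0 : ℝ) < 0 ∨ ((0 : ℝ) = 0 ∧ y < x)).card < t := ⟨_, fun _ => rfl⟩
  have hScard : ∀ t, t ≤ q → (S t).card = t := fun t ht => by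
    rw [hS]
    exact ResidueNormalFormAux.card_filter_rank_lt D (fun _ => (0 : ℝ)) (ht.trans hD)
  have hSmono : ∀ t₁ t₂, t₁ ≤ t₂ → S t₁ ⊆ S t₂ := fun t₁ t₂ h x hx => by
    rw [hS, Finset.mem_filter] at hx ⊢
    exact ⟨hx.1, lt_of_lt_of_le hx.2 h⟩
  have hSD : ∀ t, S t ⊆ D := fun t => by
    rw [hS]
    exact Finset.filter_subset _ _
  have key : ∀ t₁ t₂, t₁ < t₂ → t₂ ≤ q → ∑ x ∈ S t₁, z x = ∑ x ∈ S t₂, z x →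
      ∃ E ⊆ D, E.Nonempty ∧ ∑ x ∈ E, z x = 0 := by
    intro t₁ t₂ hlt ht₂ he
    refine ⟨S t₂ \ S t₁, Finset.sdiff_subset.trans (hSD t₂), ?_, ?_⟩
    · rw [← Finset.card_pos, Finset.card_sdiff_of_subset (hSmono t₁ t₂ hlt.le), hScard t₂ ht₂,
        hScard t₁ (hlt.le.trans ht₂)]
      omega
    · rw [Finset.sum_sdiff_eq_sub (hSmono t₁ t₂ hlt.le), he, sub_self]
  obtain ⟨t₁, ht₁, t₂, ht₂, hne, heq⟩ := Finset.exists_ne_map_eq_of_card_lt_of_maps_to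
    (s := Finset.range (q + 1)) (t := (Finset.univ : Finset (ZMod q))) (f := fun t => ∑ x ∈ S t, z x)
    (by rw [Finset.card_univ, ZMod.card, Finset.card_range]; exact Nat.lt_succ_self q)
    (fun _ _ => Finset.mem_coe.2 (Finset.mem_univ _))
  rw [Finset.mem_range] at ht₁ ht₂
  rcases lt_or_gt_of_ne hne with h | h
  · exact key t₁ t₂ h (by omega) heq
  · exact key t₂ t₁ h (by omega) heq.symm

/-- **Weighted exchange normal form, abstract ranks.**  The statement of `stub_residueWeightedNormalForm` with the
two in-class rank functions `rk` (positives, key `(c j, j)`) and `rko` (negatives, key `(-c j, j)`) abstracted into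
parameters characterised by `hrk`, `hrko`, and the canonical sets `K a b` characterised by membership (`memK`).
Proof: Davenport step `|D| < q` by `exists_zero_sum` applied to the signed weights, then canonicalisation class by
class as in `ResidueNormalFormAux.normalForm_of_rank`. [folklore: Davenport exchange argument] -/
theorem weightedNormalForm_of_rank (N q r : ℕ) (hq : 1 ≤ q) (g : Fin N → ℕ) (c : Fin N → ℝ)
    (hc : ∀ j, c j ≠ 0) (J : Finset (Fin N)) (hJ : (∑ j ∈ J, g j) % q = r % q)
    (hmax : ∀ J' : Finset (Fin N), (∑ j ∈ J', g j) % q = r % q → ∑ j ∈ J', c j ≤ ∑ j ∈ J, c j)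
    (rk rko : Fin N → ℕ)
    (hrk : ∀ j, rk j = ((Finset.univ.filter fun z : Fin N => g z % q = g j % q ∧ 0 < c z).filter
        fun z => c z < c j ∨ (c z = c j ∧ z < j)).card)
    (hrko : ∀ j, rko j = ((Finset.univ.filter fun z : Fin N => g z % q = g j % q ∧ c z < 0).filter
        fun z => -c z < -c j ∨ (-c z = -c j ∧ z < j)).card)
    (K : (ℕ → ℕ) → (ℕ → ℕ) → Finset (Fin N))
    (memK : ∀ a b j, j ∈ K a b ↔ (0 < c j ∧ b (g j % q) ≤ rk j) ∨ (c j < 0 ∧ rko j < a (g j % q))) :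
    ∃ a b : ℕ → ℕ, (∑ h ∈ Finset.range q, (a h + b h) < q) ∧ (∀ h, q ≤ h → a h = 0 ∧ b h = 0) ∧
      (∑ j ∈ K a b, g j) % q = r % q ∧ ∑ j ∈ K a b, c j = ∑ j ∈ J, c j := by
  have hq0 : 0 < q := hq
  have hcl : ∀ j, g j % q ∈ Finset.range q := fun j => Finset.mem_range.2 (Nat.mod_lt _ hq0)
  -- the residue classes, split by sign
  obtain ⟨P, hP⟩ : ∃ P : ℕ → Finset (Fin N),
      ∀ i, P i = Finset.univ.filter fun z : Fin N => g z % q = i ∧ 0 < c z := ⟨_, fun _ => rfl⟩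
  obtain ⟨M, hM⟩ : ∃ M : ℕ → Finset (Fin N),
      ∀ i, M i = Finset.univ.filter fun z : Fin N => g z % q = i ∧ c z < 0 := ⟨_, fun _ => rfl⟩
  have memP : ∀ i j, j ∈ P i ↔ g j % q = i ∧ 0 < c j := fun i j => by rw [hP]; simp
  have memM : ∀ i j, j ∈ M i ↔ g j % q = i ∧ c j < 0 := fun i j => by rw [hM]; simp
  have hrk' : ∀ j, rk j = ((P (g j % q)).filter fun z => c z < c j ∨ (c z = c j ∧ z < j)).card :=
    fun j => by rw [hrk, hP]
  have hrko' : ∀ j, rko j = ((M (g j % q)).filter fun z => -c z < -c j ∨ (-c z = -c j ∧ z < j)).card :=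
    fun j => by rw [hrko, hM]
  have hPM : ∀ i, Disjoint (P i) (M i) := fun i =>
    Finset.disjoint_left.2 fun x hxP hxM => lt_asymm ((memP i x).1 hxP).2 ((memM i x).1 hxM).2
  have hPe : ∀ i, q ≤ i → P i = ∅ := fun i hi => by
    rw [hP]
    exact Finset.filter_false_of_mem fun z _ hz => absurd hz.1 (ne_of_lt (lt_of_lt_of_le (Nat.mod_lt _ hq0) hi))
  have hMe : ∀ i, q ≤ i → M i = ∅ := fun i hi => by
    rw [hM]
    exact Finset.filter_false_of_mem fun z _ hz => absurd hz.1 (ne_of_lt (lt_of_lt_of_le (Nat.mod_lt _ hq0) hi))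
  -- the parameters `a i = |M i ∩ J|`, `b i = |P i \ J|`
  obtain ⟨a, ha⟩ : ∃ a : ℕ → ℕ, ∀ i, a i = (M i ∩ J).card := ⟨_, fun _ => rfl⟩
  obtain ⟨b, hb⟩ : ∃ b : ℕ → ℕ, ∀ i, b i = (P i \ J).card := ⟨_, fun _ => rfl⟩
  -- the exchange set `D`: chosen negatives and omitted positives
  obtain ⟨D, hD⟩ : ∃ D : Finset (Fin N), D = Finset.univ.filter fun z : Fin N =>
      (c z < 0 ∧ z ∈ J) ∨ (0 < c z ∧ z ∉ J) := ⟨_, rfl⟩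
  have memD : ∀ x, x ∈ D ↔ (c x < 0 ∧ x ∈ J) ∨ (0 < c x ∧ x ∉ J) := fun x => by rw [hD]; simp
  have hDfib : ∀ i, D.filter (fun j => g j % q = i) = (M i ∩ J) ∪ (P i \ J) := fun i => by
    ext x
    simp only [Finset.mem_filter, memD, Finset.mem_union, Finset.mem_inter, Finset.mem_sdiff, memM, memP]
    tauto
  have hDcard : D.card = ∑ i ∈ Finset.range q, (a i + b i) := by
    rw [Finset.card_eq_sum_card_fiberwise (s := D) (t := Finset.range q) (f := fun j => g j % q)
      fun x _ => hcl x]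
    refine Finset.sum_congr rfl fun i _ => ?_
    rw [hDfib, Finset.card_union_of_disjoint
      ((hPM i).symm.mono Finset.inter_subset_left Finset.sdiff_subset), ha, hb]
  -- (1) DAVENPORT STEP: `|D| < q`
  have hDlt : D.card < q := by
    by_contra hge
    rw [not_lt] at hge
    haveI : NeZero q := NeZero.of_pos hq0
    obtain ⟨E, hED, hEne, hEsum⟩ := exists_zero_sum D
      (fun j => if j ∈ J then -((g j : ℕ) : ZMod q) else ((g j : ℕ) : ZMod q)) hge
    -- `E₁ := E \ J ⊆ P \ J` (to be added) and `E₂ := E ∩ J ⊆ M ∩ J` (to be removed)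
    have hE₁ : ∀ x ∈ E.filter (fun x => x ∉ J), 0 < c x ∧ x ∉ J := fun x hx => by
      obtain ⟨hxE, hxJ⟩ := Finset.mem_filter.1 hx
      rcases (memD x).1 (hED hxE) with h | h
      · exact absurd h.2 hxJ
      · exact h
    have hE₂ : ∀ x ∈ E.filter (fun x => x ∈ J), c x < 0 ∧ x ∈ J := fun x hx => by
      obtain ⟨hxE, hxJ⟩ := Finset.mem_filter.1 hx
      rcases (memD x).1 (hED hxE) with h | h
      · exact h
      · exact absurd hxJ h.2
    have hsub : E.filter (fun x => x ∈ J) ⊆ J := fun x hx => (hE₂ x hx).2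
    have hdisj : Disjoint (J \ E.filter fun x => x ∈ J) (E.filter fun x => x ∉ J) :=
      Finset.disjoint_left.2 fun x hx hx' => (hE₁ x hx').2 (Finset.mem_sdiff.1 hx).1
    -- the signed weight of `E` vanishes: `Σ_{E₁} g ≡ Σ_{E₂} g (mod q)`
    have hmodE : (∑ x ∈ E.filter (fun x => x ∉ J), g x) % q =
        (∑ x ∈ E.filter (fun x => x ∈ J), g x) % q := by
      rw [Finset.sum_ite, Finset.sum_neg_distrib, neg_add_eq_sub, sub_eq_zero] at hEsum
      refine (ZMod.natCast_eq_natCast_iff' _ _ _).1 ?_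
      rw [Nat.cast_sum, Nat.cast_sum]
      exact hEsum
    -- the toggled set `(J \ E₂) ∪ E₁` is admissible ...
    have hadm : (∑ x ∈ (J \ E.filter fun x => x ∈ J) ∪ E.filter (fun x => x ∉ J), g x) % q = r % q := by
      rw [Finset.sum_union hdisj, Nat.add_mod, hmodE, ← Nat.add_mod, Finset.sum_sdiff hsub]
      exact hJ
    -- ... and strictly better than `J`
    have hle := hmax _ hadm
    rw [Finset.sum_union hdisj] at hle
    have hsd := Finset.sum_sdiff (f := c) hsub
    have h1 : 0 ≤ ∑ x ∈ E.filter (fun x => x ∉ J), c x := Finset.sum_nonneg fun x hx => (hE₁ x hx).1.le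
    have h2 : ∑ x ∈ E.filter (fun x => x ∈ J), c x ≤ 0 := Finset.sum_nonpos fun x hx => (hE₂ x hx).1.le
    rcases (E.filter fun x => x ∉ J).eq_empty_or_nonempty with h0 | hne
    · -- all of `E` lies in `J`: removing `E ⊆ M` strictly increases the value
      have hEJ : ∀ x ∈ E, x ∈ J := fun x hx => by
        by_contra hxJ
        have hx' : x ∈ E.filter (fun x => x ∉ J) := Finset.mem_filter.2 ⟨hx, hxJ⟩
        rw [h0] at hx'
        simp at hx'
      have h3 : ∑ x ∈ E.filter (fun x => x ∈ J), c x < 0 := by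
        rw [Finset.filter_true_of_mem hEJ]
        exact Finset.sum_neg (fun x hx => (hE₂ x (Finset.mem_filter.2 ⟨hx, hEJ x hx⟩)).1) hEne
      linarith
    · -- some omitted positive is added
      have h3 : 0 < ∑ x ∈ E.filter (fun x => x ∉ J), c x := Finset.sum_pos (fun x hx => (hE₁ x hx).1) hne
      linarith
  -- (2) cardinalities of the canonical pieces
  have hbP : ∀ i, b i ≤ (P i).card := fun i => by rw [hb]; exact Finset.card_le_card Finset.sdiff_subset
  have haM : ∀ i, a i ≤ (M i).card := fun i => by rw [ha]; exact Finset.card_le_card Finset.inter_subset_left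
  have hDc : ∀ i, ((P i).filter fun x =>
      ((P i).filter fun z => c z < c x ∨ (c z = c x ∧ z < x)).card < b i).card = b i :=
    fun i => ResidueNormalFormAux.card_filter_rank_lt (P i) c (hbP i)
  have hUc : ∀ i, ((M i).filter fun x =>
      ((M i).filter fun z => -c z < -c x ∨ (-c z = -c x ∧ z < x)).card < a i).card = a i :=
    fun i => ResidueNormalFormAux.card_filter_rank_lt (M i) (fun j => -c j) (haM i)
  have hKPc : ∀ i, ((P i).filter fun x =>
      ¬ ((P i).filter fun z => c z < c x ∨ (c z = c x ∧ z < x)).card < b i).card = (P i).card - b i := by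
    intro i
    have h : ((P i).filter fun x => ((P i).filter fun z => c z < c x ∨ (c z = c x ∧ z < x)).card < b i).card +
        ((P i).filter fun x => ¬ ((P i).filter fun z => c z < c x ∨ (c z = c x ∧ z < x)).card < b i).card =
          (P i).card :=
      Finset.card_filter_add_card_filter_not _
    rw [hDc i] at h
    omega
  -- (3) the canonical set `K a b`, class by class: kept positives and added negatives
  refine ⟨a, b, by rw [← hDcard]; exact hDlt, fun i hi => ⟨by rw [ha, hMe i hi, Finset.empty_inter,
    Finset.card_empty], by rw [hb, hPe i hi, Finset.empty_sdiff, Finset.card_empty]⟩, ?_⟩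
  have hKB : ∀ i, (K a b).filter (fun j => g j % q = i) =
      ((P i).filter fun x => ¬ ((P i).filter fun z => c z < c x ∨ (c z = c x ∧ z < x)).card < b i) ∪
      ((M i).filter fun x => ((M i).filter fun z => -c z < -c x ∨ (-c z = -c x ∧ z < x)).card < a i) := by
    intro i
    ext j
    simp only [Finset.mem_filter, Finset.mem_union, memK, memP, memM]
    constructor
    · rintro ⟨h | h, hji⟩
      · subst hji
        refine Or.inl ⟨⟨rfl, h.1⟩, ?_⟩
        rw [not_lt, ← hrk' j]
        exact h.2
      · subst hji
        refine Or.inr ⟨⟨rfl, h.1⟩, ?_⟩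
        rw [← hrko' j]
        exact h.2
    · rintro (⟨⟨hji, hpos⟩, h⟩ | ⟨⟨hji, hneg⟩, h⟩)
      · subst hji
        refine ⟨Or.inl ⟨hpos, ?_⟩, rfl⟩
        rw [hrk' j, ← not_lt]
        exact h
      · subst hji
        refine ⟨Or.inr ⟨hneg, ?_⟩, rfl⟩
        rw [hrko' j]
        exact h
  -- class `i` of `J`
  have hJB : ∀ i, J.filter (fun j => g j % q = i) = (P i ∩ J) ∪ (M i ∩ J) := by
    intro i
    ext j
    simp only [Finset.mem_filter, Finset.mem_union, Finset.mem_inter, memP, memM]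
    constructor
    · rintro ⟨hj, hji⟩
      rcases lt_or_gt_of_ne (hc j) with h | h
      · exact Or.inr ⟨⟨hji, h⟩, hj⟩
      · exact Or.inl ⟨⟨hji, h⟩, hj⟩
    · rintro (⟨⟨hji, -⟩, hj⟩ | ⟨⟨hji, -⟩, hj⟩) <;> exact ⟨hj, hji⟩
  have hdisjK : ∀ i, Disjoint
      ((P i).filter fun x => ¬ ((P i).filter fun z => c z < c x ∨ (c z = c x ∧ z < x)).card < b i)
      ((M i).filter fun x => ((M i).filter fun z => -c z < -c x ∨ (-c z = -c x ∧ z < x)).card < a i) :=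
    fun i => Finset.disjoint_filter_filter (hPM i)
  have hdisjJ : ∀ i, Disjoint (P i ∩ J) (M i ∩ J) := fun i =>
    (hPM i).mono Finset.inter_subset_left Finset.inter_subset_left
  -- (4) same class counts as `J`, hence the same weight residue: admissible
  have hcardK : ∀ i, ((K a b).filter fun j => g j % q = i).card = (J.filter fun j => g j % q = i).card := by
    intro i
    rw [hKB, hJB, Finset.card_union_of_disjoint (hdisjK i), Finset.card_union_of_disjoint (hdisjJ i), hKPc,
      hUc]
    have h1 := Finset.card_sdiff_add_card_inter (P i) J
    rw [← hb] at h1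
    rw [← ha]
    omega
  have hmodK : ∑ j ∈ K a b, g j % q = ∑ j ∈ J, g j % q := by
    rw [← Finset.sum_fiberwise_of_maps_to (s := K a b) (t := Finset.range q) (g := fun j => g j % q)
        (fun j _ => hcl j), ← Finset.sum_fiberwise_of_maps_to (s := J) (t := Finset.range q)
        (g := fun j => g j % q) (fun j _ => hcl j)]
    refine Finset.sum_congr rfl fun i _ => ?_
    rw [Finset.sum_const_nat (m := i) fun j hj => (Finset.mem_filter.1 hj).2,
      Finset.sum_const_nat (m := i) fun j hj => (Finset.mem_filter.1 hj).2, hcardK]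
  have hKadm : (∑ j ∈ K a b, g j) % q = r % q := by
    rw [Finset.sum_nat_mod, hmodK, ← Finset.sum_nat_mod]
    exact hJ
  -- (5) class by class, `J` is worth at most `K a b`
  have hsumle : ∀ i, ∑ j ∈ J.filter (fun j => g j % q = i), c j ≤
      ∑ j ∈ (K a b).filter (fun j => g j % q = i), c j := by
    intro i
    rw [hKB, hJB, Finset.sum_union (hdisjK i), Finset.sum_union (hdisjJ i)]
    apply add_le_add
    · -- positives: `K` omits the `b i` cheapest, `J` omits some `b i` of them
      have h1 := Finset.sum_inter_add_sum_sdiff (P i) J c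
      have h2 : ∑ x ∈ (P i).filter
            (fun x => ((P i).filter fun z => c z < c x ∨ (c z = c x ∧ z < x)).card < b i), c x +
          ∑ x ∈ (P i).filter
            (fun x => ¬ ((P i).filter fun z => c z < c x ∨ (c z = c x ∧ z < x)).card < b i), c x =
          ∑ x ∈ P i, c x :=
        Finset.sum_filter_add_sum_filter_not _ _ _
      have h3 : ∑ x ∈ (P i).filter
          (fun x => ((P i).filter fun z => c z < c x ∨ (c z = c x ∧ z < x)).card < b i), c x ≤
          ∑ x ∈ P i \ J, c x := by
        rw [hb]
        exact ResidueNormalFormAux.sum_filter_rank_lt_le (P i) c Finset.sdiff_subset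
      linarith
    · -- negatives: `K` takes the `a i` closest to `0`, `J` takes some `a i` of them
      have h3 : ∑ x ∈ (M i).filter
            (fun x => ((M i).filter fun z => -c z < -c x ∨ (-c z = -c x ∧ z < x)).card < a i), -c x ≤
          ∑ x ∈ M i ∩ J, -c x := by
        rw [ha]
        exact ResidueNormalFormAux.sum_filter_rank_lt_le (M i) (fun j => -c j) Finset.inter_subset_left
      rw [Finset.sum_neg_distrib, Finset.sum_neg_distrib, neg_le_neg_iff] at h3
      exact h3
  refine ⟨hKadm, le_antisymm (hmax _ hKadm) ?_⟩
  rw [← Finset.sum_fiberwise_of_maps_to (s := J) (t := Finset.range q) (g := fun j => g j % q)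
      (fun j _ => hcl j) c, ← Finset.sum_fiberwise_of_maps_to (s := K a b) (t := Finset.range q)
      (g := fun j => g j % q) (fun j _ => hcl j) c]
  exact Finset.sum_le_sum fun i _ => hsumle i

end ResidueWeightedNormalFormAux

/-- **Davenport exchange normal form for weighted residues** (piece R1 of THEOREM G″ of line
`binomial-normal-form`).  Nonzero values `c j`, weights `g j`, modulus `q ≥ 1`, residue `r`; `J` is admissible iff
`Σ_J g ≡ r (mod q)`.  Every admissible maximiser `J` of `Σ_J c` has the value of a canonical admissible set
`canon a b`: all positives except, in each residue class `h = g j % q`, its `b h` cheapest (in-class rank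
`#{j' | g j' % q = g j % q, 0 < c j', (c j', j') < (c j, j)} ≥ b h` is kept), plus the `a h` negatives closest to
`0` (rank `#{j' | g j' % q = g j % q, c j' < 0, c j < c j' ∨ (c j' = c j ∧ j' < j)} < a h` is added), where
`Σ_{h < q} (a h + b h) < q` and `a h = b h = 0` for `h ≥ q`.  Proof:
`ResidueWeightedNormalFormAux.weightedNormalForm_of_rank` (Davenport step `|J ∆ P| < q` by pigeonhole on prefix
sums in `ZMod q`, then lowest-out / highest-in canonicalisation class by class). [folklore: exchange argument] -/
theorem stub_residueWeightedNormalForm (N q r : ℕ) (hq : 1 ≤ q) (g : Fin N → ℕ) (c : Fin N → ℝ)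
    (hc : ∀ j, c j ≠ 0) (J : Finset (Fin N)) (hJ : (∑ j ∈ J, g j) % q = r % q)
    (hmax : ∀ J' : Finset (Fin N), (∑ j ∈ J', g j) % q = r % q → ∑ j ∈ J', c j ≤ ∑ j ∈ J, c j)
    (canon : (ℕ → ℕ) → (ℕ → ℕ) → Finset (Fin N))
    (hcanon : ∀ a b, canon a b = Finset.univ.filter fun j : Fin N =>
        (0 < c j ∧ b (g j % q) ≤ (Finset.univ.filter fun j' : Fin N =>
            g j' % q = g j % q ∧ 0 < c j' ∧ (c j' < c j ∨ (c j' = c j ∧ j' < j))).card) ∨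
        (c j < 0 ∧ (Finset.univ.filter fun j' : Fin N =>
            g j' % q = g j % q ∧ c j' < 0 ∧ (c j < c j' ∨ (c j' = c j ∧ j' < j))).card < a (g j % q))) :
    ∃ a b : ℕ → ℕ, (∑ h ∈ Finset.range q, (a h + b h) < q) ∧ (∀ h, q ≤ h → a h = 0 ∧ b h = 0) ∧
      (∑ j ∈ canon a b, g j) % q = r % q ∧ ∑ j ∈ canon a b, c j = ∑ j ∈ J, c j := by
  refine ResidueWeightedNormalFormAux.weightedNormalForm_of_rank N q r hq g c hc J hJ hmax
    (fun j => (Finset.univ.filter fun j' : Fin N =>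
      g j' % q = g j % q ∧ 0 < c j' ∧ (c j' < c j ∨ (c j' = c j ∧ j' < j))).card)
    (fun j => (Finset.univ.filter fun j' : Fin N =>
      g j' % q = g j % q ∧ c j' < 0 ∧ (c j < c j' ∨ (c j' = c j ∧ j' < j))).card)
    (fun j => by
      congr 1
      ext z
      simp only [Finset.mem_filter, Finset.mem_univ, true_and, and_assoc])
    (fun j => by
      congr 1
      ext z
      simp only [Finset.mem_filter, Finset.mem_univ, true_and, and_assoc, neg_lt_neg_iff, neg_inj])
    canon fun a b j => ?_
  rw [hcanon]
  simp only [Finset.mem_filter, Finset.mem_univ, true_and]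

end Summit.ValiantsHypothesis.ValiantsHypothesis.Theorems.NewtonUnitEquationsNewtonTauWeak

end
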